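import Summits.QuantumFields.GaugeBoot.Rows.KZL2HD4Emb
import Summits.QuantumFields.GaugeBoot.Certificates.KZL2HD4TabA
import Summits.QuantumFields.GaugeBoot.Certificates.KZL2rpD4TabA
import HarnessLib

/-!
# Gauge-boot: kernel check — lean3's kz-L2-H-4D entry tables are the relabelled kz-L2-rp-4D tables, blocks 12–16

Cell `pub-gaugeboot`, seat lean1 — kz-L2-H-4D (`KZL2HD4`: SU(2), D = 4, Kazakov–Zheng Λ ≤ 2 hierarchy, Hermitian blocks only;
rows C61–C75 / C118–C122 of the CERTIFIED ledger) torus positivity layer, obtained by RELABELLING the landed kz-L2-rp-4D layer.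

HONEST FRAMING (page 1 of every file of this cell): certified bounds on lattice expectations at STATED coupling,
gauge group, dimension and torus size; NOT a mass gap, NOT a continuum limit, NOT a string tension, NOT large `N`.
The venture is explicitly NOT Yang–Mills-summit-bearing (barriers `FixedCouplingUltralocality`,
`PerturbativeInvisibility`).

For each block `k` of this part: `∀ i j < 30, (Sparse.ent KZL2HD4.EB k i j).map embPair = Sparse.ent KZL2rpD4.EB k i j` by
`decide +kernel` (block dimensions ≤ 30 on both sides; terms in these blocks: 24687).  Pure kernel data check;
nothing is claimed about lattice gauge theory in this file.
-/

namespace Summit.QuantumFields.GaugeBoot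

namespace KZL2HD4

open Summit.QuantumFields.GaugeBoot.Certificates

set_option maxHeartbeats 0 in
/-- Block 12 (2442 terms): lean3's `KZL2HD4` entries relabelled by `emb` = lean3's `KZL2rpD4` entries. -/
theorem entChk_12 : ∀ i j : Fin 30, (Sparse.ent KZL2HD4.EB 12 i.val j.val).map embPair = Sparse.ent KZL2rpD4.EB 12 i.val j.val := by
  decide +kernel

set_option maxHeartbeats 0 in
/-- Block 13 (16788 terms): lean3's `KZL2HD4` entries relabelled by `emb` = lean3's `KZL2rpD4` entries. -/
theorem entChk_13 : ∀ i j : Fin 30, (Sparse.ent KZL2HD4.EB 13 i.val j.val).map embPair = Sparse.ent KZL2rpD4.EB 13 i.val j.val := by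
  decide +kernel

set_option maxHeartbeats 0 in
/-- Block 14 (1986 terms): lean3's `KZL2HD4` entries relabelled by `emb` = lean3's `KZL2rpD4` entries. -/
theorem entChk_14 : ∀ i j : Fin 30, (Sparse.ent KZL2HD4.EB 14 i.val j.val).map embPair = Sparse.ent KZL2rpD4.EB 14 i.val j.val := by
  decide +kernel

set_option maxHeartbeats 0 in
/-- Block 15 (1952 terms): lean3's `KZL2HD4` entries relabelled by `emb` = lean3's `KZL2rpD4` entries. -/
theorem entChk_15 : ∀ i j : Fin 30, (Sparse.ent KZL2HD4.EB 15 i.val j.val).map embPair = Sparse.ent KZL2rpD4.EB 15 i.val j.val := by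
  decide +kernel

set_option maxHeartbeats 0 in
/-- Block 16 (1519 terms): lean3's `KZL2HD4` entries relabelled by `emb` = lean3's `KZL2rpD4` entries. -/
theorem entChk_16 : ∀ i j : Fin 30, (Sparse.ent KZL2HD4.EB 16 i.val j.val).map embPair = Sparse.ent KZL2rpD4.EB 16 i.val j.val := by
  decide +kernel

end KZL2HD4

end Summit.QuantumFields.GaugeBoot
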